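import Mathlib.RingTheory.UniqueFactorizationDomain.Multiplicity
import Mathlib.RingTheory.Polynomial.UniqueFactorization
import Mathlib.Algebra.Polynomial.Degree.Lemmas
import Mathlib.RingTheory.MvPolynomial.Basic
import Mathlib.RingTheory.Ideal.Maps
import HarnessLib

/-!
# [OURS · L1 W4.6 rung (iii-2), piece (T)] Surface Moh window — POLYNOMIAL TOOLS over the residue field: the exceptional
# plane `κ[Y, Z]` of a point blow-up, its line `Z = 0`, and tame binary forms (cell res-hironaka, LADDER-RESOLUTION rung L,
# D-0089; unit res-L1-s46-pv-12 carried by res-D-pv-050; host MarkedTransfer, `--supports stmt-ResolutionOfSingularities-16155 --as helper`)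

HONEST FRAMING. Nothing here is a statement of H. Hironaka's manuscript [Hironaka2017] and nothing here asserts that any statement
of it holds. PURE ALGEBRA over a field `κ` (the residue field of a window point), used by the one-blow-up step of rung (iii-2)
«tame SURFACE Moh window» (companion `…MohWindowSurfaceChart.lean`) through the tree's chart isomorphism
`chartQuotEquiv : (R/𝔪)[Y, Z] ≃ B/(x)` (`Resolution/BlowupChartRsop.lean`):
* `exists_eq_X_mul_add_aeval` — in a polynomial ring on two letters `Y, Z`, every element is `Z · Q₁ + Q₀(Y)`;
* `ideal_eq_span_X_sup_map` — an ideal containing `Z` is `(Z) + 𝔫₀ κ[Y, Z]` with `𝔫₀` its trace on `κ[Y]`;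
* `not_pow_dvd_of_tame` / `exists_eq_pow_mul_of_tame` — TAMENESS («no `κ`-rational linear factor of multiplicity `≥ p`» of a
  polynomial of degree `< 2p`) forbids `π^p ∣ F` for EVERY prime `π`, so `F = π^μ · G` with `π ∤ G` and `μ < p`.
AI-written; AI review is weaker than expert review. No `sorry`; axioms standard. [folklore]
-/

noncomputable section

set_option linter.dupNamespace false -- mandated namespace of this single-conjunct summit

namespace Summit.ResolutionOfSingularities.ResolutionOfSingularities.Theorems.CampaignW46.MohWindowSurface

open Polynomial

variable {κ : Type*} [Field κ] {σ : Type*}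

/-! ## 1. Division by a variable in a two-letter polynomial ring -/

/-- In `κ[Y, Z]` (any index type with exactly the two letters `sY`, `sZ`) every polynomial is `Z · Q₁ + Q₀(Y)` with `Q₀` a
polynomial in `Y` alone. [folklore] -/
theorem exists_eq_X_mul_add_aeval (sY sZ : σ) (hσ : ∀ s : σ, s = sY ∨ s = sZ) (Q : MvPolynomial σ κ) :
    ∃ (Q₁ : MvPolynomial σ κ) (Q₀ : κ[X]),
      Q = MvPolynomial.X sZ * Q₁ + Polynomial.aeval (MvPolynomial.X sY) Q₀ := by
  induction Q using MvPolynomial.induction_on with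
  | C a => exact ⟨0, Polynomial.C a, by simp⟩
  | add P Q hP hQ =>
    obtain ⟨P₁, P₀, rfl⟩ := hP
    obtain ⟨Q₁, Q₀, rfl⟩ := hQ
    exact ⟨P₁ + Q₁, P₀ + Q₀, by simp only [map_add]; ring⟩
  | mul_X P s hP =>
    obtain ⟨P₁, P₀, rfl⟩ := hP
    rcases hσ s with rfl | rfl
    · exact ⟨P₁ * MvPolynomial.X s, P₀ * Polynomial.X, by simp only [map_mul, Polynomial.aeval_X]; ring⟩
    · exact ⟨P₁ * MvPolynomial.X s + Polynomial.aeval (MvPolynomial.X sY) P₀, 0, by simp only [map_zero]; ring⟩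

/-- **An ideal of `κ[Y, Z]` containing `Z` is `(Z) + 𝔫₀ · κ[Y, Z]`**, `𝔫₀` its trace on `κ[Y]`. [folklore] -/
theorem ideal_eq_span_X_sup_map (sY sZ : σ) (hσ : ∀ s : σ, s = sY ∨ s = sZ) (𝔫 : Ideal (MvPolynomial σ κ))
    (hZ : MvPolynomial.X sZ ∈ 𝔫) :
    𝔫 = Ideal.span {MvPolynomial.X sZ} ⊔
      (𝔫.comap (Polynomial.aeval (MvPolynomial.X sY) : κ[X] →ₐ[κ] MvPolynomial σ κ).toRingHom).map
        (Polynomial.aeval (MvPolynomial.X sY) : κ[X] →ₐ[κ] MvPolynomial σ κ).toRingHom := by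
  apply le_antisymm
  · intro Q hQ
    obtain ⟨Q₁, Q₀, hQeq⟩ := exists_eq_X_mul_add_aeval sY sZ hσ Q
    have hQ₀ : Q₀ ∈ 𝔫.comap (Polynomial.aeval (MvPolynomial.X sY) : κ[X] →ₐ[κ] MvPolynomial σ κ).toRingHom := by
      rw [Ideal.mem_comap]
      have : (Polynomial.aeval (MvPolynomial.X sY) : κ[X] →ₐ[κ] MvPolynomial σ κ).toRingHom Q₀ =
          Q - MvPolynomial.X sZ * Q₁ := by
        rw [hQeq]; simp
      rw [this]
      exact Ideal.sub_mem _ hQ (Ideal.mul_mem_right _ _ hZ)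
    rw [hQeq]
    exact Submodule.add_mem_sup (Ideal.mul_mem_right _ _ (Ideal.mem_span_singleton_self _))
      (Ideal.mem_map_of_mem _ hQ₀)
  · refine sup_le ?_ Ideal.map_comap_le
    rw [Ideal.span_le, Set.singleton_subset_iff]
    exact hZ

/-! ## 2. Tame polynomials: no `p`-th power of a prime divides -/

/-- A polynomial of degree `< 2p` with no `κ`-rational linear factor of multiplicity `≥ p` is divisible by NO `p`-th power of a
prime: such a prime would have degree `1`. [folklore] -/
theorem not_pow_dvd_of_tame {p d : ℕ} (hd : d < 2 * p) {F : κ[X]} (hdeg : F.natDegree ≤ d)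
    (htame : ∀ t : κ, ¬ (X - C t) ^ p ∣ F) {π : κ[X]} (hπ : Prime π) : ¬ π ^ p ∣ F := by
  intro hdvd
  have hF0 : F ≠ 0 := fun h => htame 0 (by rw [h]; exact dvd_zero _)
  have hπ0 : π ≠ 0 := hπ.ne_zero
  -- degree count: `p · deg π ≤ d < 2p`, so `deg π ≤ 1`; a prime is not constant, so `deg π = 1`
  have hdegle : (π ^ p).natDegree ≤ F.natDegree := Polynomial.natDegree_le_of_dvd hdvd hF0
  rw [Polynomial.natDegree_pow] at hdegle
  have hπpos : 0 < π.natDegree := Polynomial.natDegree_pos_iff_degree_pos.mpr (Polynomial.degree_pos_of_irreducible hπ.irreducible)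
  have hπ1 : π.natDegree = 1 := by
    by_contra hne
    have h2 : 2 ≤ π.natDegree := by omega
    have : p * 2 ≤ p * π.natDegree := Nat.mul_le_mul_left p h2
    omega
  obtain ⟨a, ha, b, hab⟩ := Polynomial.natDegree_eq_one.mp hπ1
  -- `π = a (X − t)` with `t = −b/a`
  have hπeq : π = C a * (X - C (-b / a)) := by
    rw [← hab]
    have : C a * C (-b / a) = -C b := by
      rw [← map_mul, ← map_neg, mul_comm, div_mul_cancel₀ _ ha]
    rw [mul_sub, this, sub_neg_eq_add]
  refine htame (-b / a) (dvd_trans ?_ hdvd)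
  rw [hπeq, mul_pow]
  exact Dvd.intro_left _ rfl

/-- **Tame factorisation.** For `F` of degree `≤ d < 2p`, tame, and a prime `π` of `κ[Y]`: `F = π^μ · G` with `π ∤ G` and
`μ < p`. [folklore] -/
theorem exists_eq_pow_mul_of_tame {p d : ℕ} (hd : d < 2 * p) {F : κ[X]} (hdeg : F.natDegree ≤ d)
    (htame : ∀ t : κ, ¬ (X - C t) ^ p ∣ F) {π : κ[X]} (hπ : Prime π) :
    ∃ (μ : ℕ) (G : κ[X]), μ < p ∧ F = π ^ μ * G ∧ ¬ π ∣ G := by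
  have hF0 : F ≠ 0 := fun h => htame 0 (by rw [h]; exact dvd_zero _)
  obtain ⟨μ, G, hndvd, hFeq⟩ := WfDvdMonoid.max_power_factor' hF0 hπ.not_unit
  refine ⟨μ, G, ?_, hFeq, hndvd⟩
  by_contra hμ
  rw [not_lt] at hμ
  refine not_pow_dvd_of_tame hd hdeg htame hπ ?_
  rw [hFeq]
  exact dvd_mul_of_dvd_left (pow_dvd_pow π hμ) G

/-- The window polynomial `Σ_{k ≤ d} c_k X^{e k}` with exponents `e k ≤ d` has degree `≤ d`. [folklore] -/
theorem natDegree_sum_C_mul_X_pow_le {d : ℕ} (c : ℕ → κ) (e : ℕ → ℕ) (he : ∀ k, e k ≤ d) :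
    (∑ k ∈ Finset.range (d + 1), C (c k) * X ^ (e k)).natDegree ≤ d := by
  refine Polynomial.natDegree_sum_le_of_forall_le _ _ fun k _ => ?_
  exact (Polynomial.natDegree_C_mul_X_pow_le (c k) (e k)).trans (he k)

/-! ## 3. Arbitrary (heavy) multiplicities: factorisation at any prime, bounded by the degree

PURE APPEND (2026-08-27, res-D-pv-050 AS res-L1-s46-pv-12 gen 5, heavy-root side = object #1 of res-D-pv-008's census
`D/res-D-pv-008/H2-CENSUS.md`): §§1–2 above byte-identical. Without tameness a prime `π` may divide the residue polynomial `F` to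
ANY power `μ ≤ deg F ≤ d`; the companion `…MohWindowSurfaceHeavyChart.lean` feeds this `μ` to `core_le`. -/

/-- **Factorisation at an arbitrary prime.** For `F ≠ 0` and a prime `π` of `κ[Y]`: `F = π^μ · G` with `π ∤ G` and `μ ≤ deg F`
(a prime has positive degree). No tameness; `μ ≥ p` allowed. [folklore] -/
theorem exists_eq_pow_mul_of_ne_zero {F : κ[X]} (hF0 : F ≠ 0) {π : κ[X]} (hπ : Prime π) :
    ∃ (μ : ℕ) (G : κ[X]), μ ≤ F.natDegree ∧ F = π ^ μ * G ∧ ¬ π ∣ G := by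
  obtain ⟨μ, G, hndvd, hFeq⟩ := WfDvdMonoid.max_power_factor' hF0 hπ.not_unit
  refine ⟨μ, G, ?_, hFeq, hndvd⟩
  have hdvd : π ^ μ ∣ F := by rw [hFeq]; exact dvd_mul_right _ _
  have hdegle : (π ^ μ).natDegree ≤ F.natDegree := Polynomial.natDegree_le_of_dvd hdvd hF0
  rw [Polynomial.natDegree_pow] at hdegle
  have hπpos : 0 < π.natDegree :=
    Polynomial.natDegree_pos_iff_degree_pos.mpr (Polynomial.degree_pos_of_irreducible hπ.irreducible)
  have h1 : μ * 1 ≤ μ * π.natDegree := Nat.mul_le_mul_left μ hπpos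
  rw [mul_one] at h1
  exact h1.trans hdegle

/-- **Factorisation of a window polynomial at an arbitrary prime**: for `F = Σ_{k ≤ d} c_k X^{e k} ≠ 0` with `e k ≤ d` and a prime
`π`: `F = π^μ · G`, `π ∤ G`, `μ ≤ d`. [folklore] -/
theorem exists_eq_pow_mul_le {d : ℕ} (c : ℕ → κ) (e : ℕ → ℕ) (he : ∀ k, e k ≤ d)
    (hF0 : ∑ k ∈ Finset.range (d + 1), C (c k) * X ^ (e k) ≠ 0) {π : κ[X]} (hπ : Prime π) :
    ∃ (μ : ℕ) (G : κ[X]), μ ≤ d ∧ (∑ k ∈ Finset.range (d + 1), C (c k) * X ^ (e k)) = π ^ μ * G ∧ ¬ π ∣ G := by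
  obtain ⟨μ, G, hμ, hFeq, hndvd⟩ := exists_eq_pow_mul_of_ne_zero hF0 hπ
  exact ⟨μ, G, hμ.trans (natDegree_sum_C_mul_X_pow_le c e he), hFeq, hndvd⟩

/-- **A window polynomial with a non-zero coefficient is non-zero** when its exponents `e k` are injective on `k ≤ d` (the two
chart shapes `e k = k` and `e k = d − k`): the coefficient of `X^{e j}` is `c_j`. [folklore] -/
theorem sum_C_mul_X_pow_ne_zero {d : ℕ} (c : ℕ → κ) (e : ℕ → ℕ) (he : Set.InjOn e (Finset.range (d + 1) : Set ℕ))
    {j : ℕ} (hj : j ≤ d) (hcj : c j ≠ 0) :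
    ∑ k ∈ Finset.range (d + 1), C (c k) * X ^ (e k) ≠ 0 := by
  intro h
  have hjr : j ∈ Finset.range (d + 1) := Finset.mem_range.mpr (Nat.lt_succ_of_le hj)
  have hcoeff : (∑ k ∈ Finset.range (d + 1), C (c k) * X ^ (e k)).coeff (e j) = c j := by
    rw [Polynomial.finsetSum_coeff]
    rw [Finset.sum_eq_single j]
    · rw [Polynomial.coeff_C_mul_X_pow, if_pos rfl]
    · intro k hk hkj
      rw [Polynomial.coeff_C_mul_X_pow, if_neg]
      intro hjk
      exact hkj (he (Finset.mem_coe.mpr hk) (Finset.mem_coe.mpr hjr) hjk.symm)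
    · intro hj'
      exact absurd hjr hj'
  rw [h, Polynomial.coeff_zero] at hcoeff
  exact hcj hcoeff.symm

/-- The chart-`x` shape: `Σ_{k ≤ d} c_k X^{min k d} ≠ 0` if some `c_j ≠ 0`, `j ≤ d`. [folklore] -/
theorem sum_C_mul_X_pow_min_ne_zero {d : ℕ} (c : ℕ → κ) {j : ℕ} (hj : j ≤ d) (hcj : c j ≠ 0) :
    ∑ k ∈ Finset.range (d + 1), C (c k) * X ^ (min k d) ≠ 0 := by
  refine sum_C_mul_X_pow_ne_zero c (fun k => min k d) ?_ hj hcj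
  intro k hk k' hk' hkk'
  have hkd : k ≤ d := Nat.lt_succ_iff.mp (Finset.mem_range.mp (Finset.mem_coe.mp hk))
  have hk'd : k' ≤ d := Nat.lt_succ_iff.mp (Finset.mem_range.mp (Finset.mem_coe.mp hk'))
  have : min k d = min k' d := hkk'
  rwa [min_eq_left hkd, min_eq_left hk'd] at this

/-- The chart-`y` shape: `Σ_{k ≤ d} c_k X^{d − k} ≠ 0` if some `c_j ≠ 0`, `j ≤ d`. [folklore] -/
theorem sum_C_mul_X_pow_sub_ne_zero {d : ℕ} (c : ℕ → κ) {j : ℕ} (hj : j ≤ d) (hcj : c j ≠ 0) :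
    ∑ k ∈ Finset.range (d + 1), C (c k) * X ^ (d - k) ≠ 0 := by
  refine sum_C_mul_X_pow_ne_zero c (fun k => d - k) ?_ hj hcj
  intro k hk k' hk' hkk'
  have hkd : k ≤ d := Nat.lt_succ_iff.mp (Finset.mem_range.mp (Finset.mem_coe.mp hk))
  have hk'd : k' ≤ d := Nat.lt_succ_iff.mp (Finset.mem_range.mp (Finset.mem_coe.mp hk'))
  have : d - k = d - k' := hkk'
  omega

end Summit.ResolutionOfSingularities.ResolutionOfSingularities.Theorems.CampaignW46.MohWindowSurface

end
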